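import Mathlib
import Summits.Ventures.PercRepro2.SepSplitDsym
import Summits.Ventures.PercRepro2.SepSplitCoincide

/-!
# Gluing at a general separator, XVI: every dead triple is doubly-symmetrised zero — the six
mechanisms of `Dead` are pointwise in the doubly symmetrised kernel (blind cell PercRepro2, mine-2
g50, 2026-08-29; `conjectures/MINE-2.md` M2-104)

`SepSplitLive` collects six vanishing mechanisms for the `S₃`-orbit sum of the glued root counts
into the predicate `Dead` (a root or a mark `o, b` frozen behind the separator, a joining datum, a
chain-single triple).  `SepSplitDsym` gives the exact criterion: the orbit sum is `1/6` of the
typed count of the DOUBLY symmetrised kernel `dsymK side p` on the root data of the three copies,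
so a far triple whose doubly symmetrised kernel vanishes on all real root data (`DsymZero`) is
dead on every root side.  THIS FILE closes the circle for `Dead`: **each of the six mechanisms is
pointwise in `dsymK`** — the symmetrised kernel vanishes on the glued states of EVERY assignment
of the far data of the triple to the three copies (`dsymK_eq_zero_of_inTriple`), for
EVERY root data, real or not — so `Dead side p → DsymZero side p` (`dsymZero_of_dead`): the
frozen roots and marks by `KBsym_eq_zero_of_H / _L / _o / _b` on the frozen parts
(`dsymZero_of_frozenA2 / _A1 / _O / _B`), the joining datum by the failure of `Q`
(`KBsym_eq_zero_of_q'`, `dsymZero_of_joined`), the chain-single triples by the trichotomy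
`chainSingle_cases` (joined, or one root isolated in all three far data — a frozen all-`false`
part).  The two pointwise deaths of `SepSplitCoincide` and the rule on the non-dead orbits through
`DsymZero` follow in `SepSplitDeadDsymRule`.  Own work; standard axioms.
-/

namespace Summit.Ventures.PercRepro2

open UnionCluster

namespace CovForm

namespace RootBridge

open OneTyped TypedA3 Untouched TypedFactor Separated

/-! ## Three pointwise vanishings of the symmetrised kernel -/

section Pointwise

/-- The symmetrised kernel vanishes when one of the three states fails `Q` (each of its six
terms does, `KB_eq_zero_of_q'`). -/
lemma KBsym_eq_zero_of_q' (x y z : St) (h : x.q' = true ∨ y.q' = true ∨ z.q' = true) :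
    KBsym x y z = 0 := by
  unfold KBsym
  rcases h with h | h | h
  · simp only [KB_eq_zero_of_q' x y z (Or.inl h), KB_eq_zero_of_q' x z y (Or.inl h),
      KB_eq_zero_of_q' y x z (Or.inr (Or.inl h)), KB_eq_zero_of_q' y z x (Or.inr (Or.inr h)),
      KB_eq_zero_of_q' z x y (Or.inr (Or.inl h)), KB_eq_zero_of_q' z y x (Or.inr (Or.inr h)),
      add_zero]
  · simp only [KB_eq_zero_of_q' x y z (Or.inr (Or.inl h)), KB_eq_zero_of_q' x z y (Or.inr (Or.inr h)),
      KB_eq_zero_of_q' y x z (Or.inl h), KB_eq_zero_of_q' y z x (Or.inl h),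
      KB_eq_zero_of_q' z x y (Or.inr (Or.inr h)), KB_eq_zero_of_q' z y x (Or.inr (Or.inl h)),
      add_zero]
  · simp only [KB_eq_zero_of_q' x y z (Or.inr (Or.inr h)), KB_eq_zero_of_q' x z y (Or.inr (Or.inl h)),
      KB_eq_zero_of_q' y x z (Or.inr (Or.inr h)), KB_eq_zero_of_q' y z x (Or.inr (Or.inl h)),
      KB_eq_zero_of_q' z x y (Or.inl h), KB_eq_zero_of_q' z y x (Or.inl h), add_zero]

/-- The symmetrised kernel vanishes on state triples with the `o`–`a₃` coincidence in each copy
(each of its six terms does, `KB_eq_zero_of_coincide`). -/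
lemma KBsym_eq_zero_of_coincide (x y z : St) (hx : x.L3 = x.Lo ∧ x.H3 = x.Ho)
    (hy : y.L3 = y.Lo ∧ y.H3 = y.Ho) (hz : z.L3 = z.Lo ∧ z.H3 = z.Ho) : KBsym x y z = 0 := by
  unfold KBsym
  simp only [KB_eq_zero_of_coincide x y z hx hy hz, KB_eq_zero_of_coincide x z y hx hz hy,
    KB_eq_zero_of_coincide y x z hy hx hz, KB_eq_zero_of_coincide y z x hy hz hx,
    KB_eq_zero_of_coincide z x y hz hx hy, KB_eq_zero_of_coincide z y x hz hy hx, add_zero]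

/-- The symmetrised kernel vanishes on state triples with `pd = 0` in each copy (each of its six
terms carries two `pd`-factors of distinct copies, `KB_eq_zero_of_pdB`). -/
lemma KBsym_eq_zero_of_pdB3 (x y z : St) (hx : pdB x = 0) (hy : pdB y = 0) (hz : pdB z = 0) :
    KBsym x y z = 0 := by
  unfold KBsym
  simp only [KB_eq_zero_of_pdB x y z hx hy, KB_eq_zero_of_pdB x z y hx hz,
    KB_eq_zero_of_pdB y x z hy hx, KB_eq_zero_of_pdB y z x hy hz,
    KB_eq_zero_of_pdB z x y hz hx, KB_eq_zero_of_pdB z y x hz hy, add_zero]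

end Pointwise

/-! ## The doubly symmetrised kernel from a pointwise vanishing on every assignment -/

section Assign

open Classical

variable {ι : Type*}

/-- **The doubly symmetrised kernel vanishes** when the symmetrised kernel vanishes on the glued
states of every assignment of far data of the triple to the three copies. -/
lemma dsymK_eq_zero_of_inTriple (side : Fin 5 → Bool) (p : Pat3S ι) (hx hy hw : SideData ι)
    (h : ∀ q₁ q₂ q₃ : SideData ι, (q₁ = p.1 ∨ q₁ = p.2.1 ∨ q₁ = p.2.2) →
      (q₂ = p.1 ∨ q₂ = p.2.1 ∨ q₂ = p.2.2) → (q₃ = p.1 ∨ q₃ = p.2.1 ∨ q₃ = p.2.2) →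
      KBsym (gluedS hx q₁ side) (gluedS hy q₂ side) (gluedS hw q₃ side) = 0) :
    dsymK side p hx hy hw = 0 := by
  have m1 : p.1 = p.1 ∨ p.1 = p.2.1 ∨ p.1 = p.2.2 := Or.inl rfl
  have m2 : p.2.1 = p.1 ∨ p.2.1 = p.2.1 ∨ p.2.1 = p.2.2 := Or.inr (Or.inl rfl)
  have m3 : p.2.2 = p.1 ∨ p.2.2 = p.2.1 ∨ p.2.2 = p.2.2 := Or.inr (Or.inr rfl)
  unfold dsymK
  simp only [h _ _ _ m1 m2 m3, h _ _ _ m2 m1 m3, h _ _ _ m1 m3 m2, h _ _ _ m3 m2 m1,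
    h _ _ _ m2 m3 m1, h _ _ _ m3 m1 m2, add_zero]

/-- `DsymZero` from the pointwise vanishing on every assignment, for every root data (real or
not). -/
lemma dsymZero_of_inTriple (side : Fin 5 → Bool) (p : Pat3S ι)
    (h : ∀ hx hy hw q₁ q₂ q₃ : SideData ι, (q₁ = p.1 ∨ q₁ = p.2.1 ∨ q₁ = p.2.2) →
      (q₂ = p.1 ∨ q₂ = p.2.1 ∨ q₂ = p.2.2) → (q₃ = p.1 ∨ q₃ = p.2.1 ∨ q₃ = p.2.2) →
      KBsym (gluedS hx q₁ side) (gluedS hy q₂ side) (gluedS hw q₃ side) = 0) :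
    DsymZero side p :=
  fun hx hy hw _ _ _ => dsymK_eq_zero_of_inTriple side p hx hy hw (h hx hy hw)

end Assign

/-! ## The frozen roots and marks -/

section Frozen

open Classical

variable {ι : Type*}

/-- Under `FrozenA2`, every datum of the triple is off the separator at `a₂` with the frozen
`a₂`-part of the third datum. -/
lemma frozenA2_inTriple {side : Fin 5 → Bool} {p : Pat3S ι} (hd : FrozenA2 side p)
    {q : SideData ι} (hq : q = p.1 ∨ q = p.2.1 ∨ q = p.2.2) : OffSep q 2 ∧ frozenH side q = frozenH side p.2.2 := by
  rcases hq with rfl | rfl | rfl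
  · exact ⟨hd.1.1, hd.2.1⟩
  · exact ⟨hd.1.2.1, hd.2.2⟩
  · exact ⟨hd.1.2.2, rfl⟩

/-- Under `FrozenA1`, every datum of the triple is off the separator at `a₁` with the frozen
`a₁`-part of the third datum. -/
lemma frozenA1_inTriple {side : Fin 5 → Bool} {p : Pat3S ι} (hd : FrozenA1 side p)
    {q : SideData ι} (hq : q = p.1 ∨ q = p.2.1 ∨ q = p.2.2) : OffSep q 1 ∧ frozenL side q = frozenL side p.2.2 := by
  rcases hq with rfl | rfl | rfl
  · exact ⟨hd.1.1, hd.2.1⟩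
  · exact ⟨hd.1.2.1, hd.2.2⟩
  · exact ⟨hd.1.2.2, rfl⟩

/-- Under `FrozenO`, every datum of the triple is off the separator at `o` with the frozen status
of `o` of the third datum. -/
lemma frozenO_inTriple {side : Fin 5 → Bool} {p : Pat3S ι} (hd : FrozenO side p)
    {q : SideData ι} (hq : q = p.1 ∨ q = p.2.1 ∨ q = p.2.2) : OffSep q 0 ∧ frozenO side q = frozenO side p.2.2 := by
  rcases hq with rfl | rfl | rfl
  · exact ⟨hd.1.1, hd.2.1⟩
  · exact ⟨hd.1.2.1, hd.2.2⟩
  · exact ⟨hd.1.2.2, rfl⟩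

/-- Under `FrozenB`, every datum of the triple is off the separator at `b` with the frozen status
of `b` of the third datum. -/
lemma frozenB_inTriple {side : Fin 5 → Bool} {p : Pat3S ι} (hd : FrozenB side p)
    {q : SideData ι} (hq : q = p.1 ∨ q = p.2.1 ∨ q = p.2.2) : OffSep q 4 ∧ frozenB side q = frozenB side p.2.2 := by
  rcases hq with rfl | rfl | rfl
  · exact ⟨hd.1.1, hd.2.1⟩
  · exact ⟨hd.1.2.1, hd.2.2⟩
  · exact ⟨hd.1.2.2, rfl⟩

/-- **`FrozenA2` ⟹ doubly-symmetrised zero**: on every assignment the three glued states share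
the frozen `a₂`-part (`KBsym_eq_zero_of_H`). -/
theorem dsymZero_of_frozenA2 (side : Fin 5 → Bool) (h2 : side 2 = true) (p : Pat3S ι)
    (hd : FrozenA2 side p) : DsymZero side p := by
  refine dsymZero_of_inTriple side p fun hx hy hw q₁ q₂ q₃ m1 m2 m3 => ?_
  obtain ⟨o1, e1⟩ := frozenA2_inTriple hd m1
  obtain ⟨o2, e2⟩ := frozenA2_inTriple hd m2
  obtain ⟨o3, e3⟩ := frozenA2_inTriple hd m3
  rw [gluedS_eq_mkSt_of_offSep_a2 hx q₁ side h2 o1, gluedS_eq_mkSt_of_offSep_a2 hy q₂ side h2 o2,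
    gluedS_eq_mkSt_of_offSep_a2 hw q₃ side h2 o3, e1, e2, e3, KBsym_eq_zero_of_H]

/-- **`FrozenA1` ⟹ doubly-symmetrised zero**: on every assignment the three glued states share
the frozen `a₁`-part (`KBsym_eq_zero_of_L`). -/
theorem dsymZero_of_frozenA1 (side : Fin 5 → Bool) (h1 : side 1 = true) (p : Pat3S ι)
    (hd : FrozenA1 side p) : DsymZero side p := by
  refine dsymZero_of_inTriple side p fun hx hy hw q₁ q₂ q₃ m1 m2 m3 => ?_
  obtain ⟨o1, e1⟩ := frozenA1_inTriple hd m1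
  obtain ⟨o2, e2⟩ := frozenA1_inTriple hd m2
  obtain ⟨o3, e3⟩ := frozenA1_inTriple hd m3
  rw [gluedS_eq_mkSt_of_offSep_a1 hx q₁ side h1 o1, gluedS_eq_mkSt_of_offSep_a1 hy q₂ side h1 o2,
    gluedS_eq_mkSt_of_offSep_a1 hw q₃ side h1 o3, e1, e2, e3, KBsym_eq_zero_of_L]

/-- **`FrozenO` ⟹ doubly-symmetrised zero**: on every assignment the three glued states share
the frozen status of `o` (`KBsym_eq_zero_of_o`). -/
theorem dsymZero_of_frozenO (side : Fin 5 → Bool) (h0 : side 0 = true) (p : Pat3S ι)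
    (hd : FrozenO side p) : DsymZero side p := by
  refine dsymZero_of_inTriple side p fun hx hy hw q₁ q₂ q₃ m1 m2 m3 => ?_
  obtain ⟨o1, e1⟩ := frozenO_inTriple hd m1
  obtain ⟨o2, e2⟩ := frozenO_inTriple hd m2
  obtain ⟨o3, e3⟩ := frozenO_inTriple hd m3
  rw [gluedS_eq_mkSt_of_offSep_o hx q₁ side h0 o1, gluedS_eq_mkSt_of_offSep_o hy q₂ side h0 o2,
    gluedS_eq_mkSt_of_offSep_o hw q₃ side h0 o3, e1, e2, e3, KBsym_eq_zero_of_o]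

/-- **`FrozenB` ⟹ doubly-symmetrised zero**: on every assignment the three glued states share
the frozen status of `b` (`KBsym_eq_zero_of_b`). -/
theorem dsymZero_of_frozenB (side : Fin 5 → Bool) (h4 : side 4 = true) (p : Pat3S ι)
    (hd : FrozenB side p) : DsymZero side p := by
  refine dsymZero_of_inTriple side p fun hx hy hw q₁ q₂ q₃ m1 m2 m3 => ?_
  obtain ⟨o1, e1⟩ := frozenB_inTriple hd m1
  obtain ⟨o2, e2⟩ := frozenB_inTriple hd m2
  obtain ⟨o3, e3⟩ := frozenB_inTriple hd m3
  rw [gluedS_eq_mkSt_of_offSep_b hx q₁ side h4 o1, gluedS_eq_mkSt_of_offSep_b hy q₂ side h4 o2,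
    gluedS_eq_mkSt_of_offSep_b hw q₃ side h4 o3, e1, e2, e3, KBsym_eq_zero_of_b]

end Frozen

/-! ## The joined and the chain-single triples -/

section Roots

open Classical

variable {ι : Type*}

/-- The symmetrised kernel on the glued states of three far data vanishes when one of them joins
`a₂` to `a₁` (that glued state fails `Q`). -/
lemma KBsym_gluedS_eq_zero_of_joined (side : Fin 5 → Bool) (h1 : side 1 = true)
    (h2 : side 2 = true) (hx hy hw q₁ q₂ q₃ : SideData ι)
    (hq : q₁.1 2 1 = true ∨ q₂.1 2 1 = true ∨ q₃.1 2 1 = true) :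
    KBsym (gluedS hx q₁ side) (gluedS hy q₂ side) (gluedS hw q₃ side) = 0 := by
  apply KBsym_eq_zero_of_q'
  rcases hq with hq | hq | hq
  · exact Or.inl (gluedS_q'_of_joined _ _ side h1 h2 hq)
  · exact Or.inr (Or.inl (gluedS_q'_of_joined _ _ side h1 h2 hq))
  · exact Or.inr (Or.inr (gluedS_q'_of_joined _ _ side h1 h2 hq))

/-- **`Joined` ⟹ doubly-symmetrised zero** (every assignment carries the joining datum). -/
theorem dsymZero_of_joined (side : Fin 5 → Bool) (h1 : side 1 = true) (h2 : side 2 = true)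
    (p : Pat3S ι) (hj : Joined p) : DsymZero side p := by
  intro hx hy hw _ _ _
  have j123 : p.1.1 2 1 = true ∨ p.2.1.1 2 1 = true ∨ p.2.2.1 2 1 = true := hj
  have j213 : p.2.1.1 2 1 = true ∨ p.1.1 2 1 = true ∨ p.2.2.1 2 1 = true := by tauto
  have j132 : p.1.1 2 1 = true ∨ p.2.2.1 2 1 = true ∨ p.2.1.1 2 1 = true := by tauto
  have j321 : p.2.2.1 2 1 = true ∨ p.2.1.1 2 1 = true ∨ p.1.1 2 1 = true := by tauto
  have j231 : p.2.1.1 2 1 = true ∨ p.2.2.1 2 1 = true ∨ p.1.1 2 1 = true := by tauto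
  have j312 : p.2.2.1 2 1 = true ∨ p.1.1 2 1 = true ∨ p.2.1.1 2 1 = true := by tauto
  unfold dsymK
  simp only [KBsym_gluedS_eq_zero_of_joined side h1 h2 hx hy hw p.1 p.2.1 p.2.2 j123,
    KBsym_gluedS_eq_zero_of_joined side h1 h2 hx hy hw p.2.1 p.1 p.2.2 j213,
    KBsym_gluedS_eq_zero_of_joined side h1 h2 hx hy hw p.1 p.2.2 p.2.1 j132,
    KBsym_gluedS_eq_zero_of_joined side h1 h2 hx hy hw p.2.2 p.2.1 p.1 j321,
    KBsym_gluedS_eq_zero_of_joined side h1 h2 hx hy hw p.2.1 p.2.2 p.1 j231,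
    KBsym_gluedS_eq_zero_of_joined side h1 h2 hx hy hw p.2.2 p.1 p.2.1 j312, add_zero]

/-- `a₂` isolated in the three far data ⟹ `FrozenA2` (the all-`false` frozen part). -/
lemma frozenA2_of_isoFar {side : Fin 5 → Bool} {p : Pat3S ι}
    (hiso : IsoFar side p.1 2 ∧ IsoFar side p.2.1 2 ∧ IsoFar side p.2.2 2) : FrozenA2 side p :=
  ⟨⟨hiso.1.1, hiso.2.1.1, hiso.2.2.1⟩,
    by rw [frozenH_eq_of_isoFar side p.1 hiso.1, frozenH_eq_of_isoFar side p.2.2 hiso.2.2],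
    by rw [frozenH_eq_of_isoFar side p.2.1 hiso.2.1, frozenH_eq_of_isoFar side p.2.2 hiso.2.2]⟩

/-- `a₁` isolated in the three far data ⟹ `FrozenA1` (the all-`false` frozen part). -/
lemma frozenA1_of_isoFar {side : Fin 5 → Bool} {p : Pat3S ι}
    (hiso : IsoFar side p.1 1 ∧ IsoFar side p.2.1 1 ∧ IsoFar side p.2.2 1) : FrozenA1 side p :=
  ⟨⟨hiso.1.1, hiso.2.1.1, hiso.2.2.1⟩,
    by rw [frozenL_eq_of_isoFar side p.1 hiso.1, frozenL_eq_of_isoFar side p.2.2 hiso.2.2],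
    by rw [frozenL_eq_of_isoFar side p.2.1 hiso.2.1, frozenL_eq_of_isoFar side p.2.2 hiso.2.2]⟩

/-- **The trichotomy of a chain-single triple with both roots far** (the case analysis of
`orbitRootS_eq_zero_of_chainSingle`): some datum joins the roots, or `a₁` is isolated in all
three far data, or `a₂` is. -/
lemma chainSingle_cases {side : Fin 5 → Bool} (h1 : side 1 = true) (h2 : side 2 = true)
    {p : Pat3S ι} (hp : ChainSingle side p) :
    Joined p ∨ (IsoFar side p.1 1 ∧ IsoFar side p.2.1 1 ∧ IsoFar side p.2.2 1) ∨
      (IsoFar side p.1 2 ∧ IsoFar side p.2.1 2 ∧ IsoFar side p.2.2 2) := by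
  obtain ⟨s1, s2, s3, c12, c13, c23⟩ := hp
  by_cases hA : (InBlock side p.1 (Sum.inr 1) ∧ InBlock side p.1 (Sum.inr 2)) ∨
      (InBlock side p.2.1 (Sum.inr 1) ∧ InBlock side p.2.1 (Sum.inr 2)) ∨
      (InBlock side p.2.2 (Sum.inr 1) ∧ InBlock side p.2.2 (Sum.inr 2))
  · left
    show p.1.1 2 1 = true ∨ p.2.1.1 2 1 = true ∨ p.2.2.1 2 1 = true
    rcases hA with ⟨a, b⟩ | ⟨a, b⟩ | ⟨a, b⟩
    · exact Or.inl (joined_of_inBlock_roots s1 a b)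
    · exact Or.inr (Or.inl (joined_of_inBlock_roots s2 a b))
    · exact Or.inr (Or.inr (joined_of_inBlock_roots s3 a b))
  · have hA1 : ¬ (InBlock side p.1 (Sum.inr 1) ∧ InBlock side p.1 (Sum.inr 2)) :=
      fun h => hA (Or.inl h)
    have hA2 : ¬ (InBlock side p.2.1 (Sum.inr 1) ∧ InBlock side p.2.1 (Sum.inr 2)) :=
      fun h => hA (Or.inr (Or.inl h))
    have hA3 : ¬ (InBlock side p.2.2 (Sum.inr 1) ∧ InBlock side p.2.2 (Sum.inr 2)) :=
      fun h => hA (Or.inr (Or.inr h))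
    by_cases hB : InBlock side p.1 (Sum.inr 2) ∨ InBlock side p.2.1 (Sum.inr 2) ∨
        InBlock side p.2.2 (Sum.inr 2)
    · right; left
      rcases hB with hc | hc | hc
      · exact ⟨isoFar_of_not_inBlock h1 fun h => hA1 ⟨h, hc⟩,
          isoFar_of_not_inBlock h1 (not_inBlock_one c12 hA1 hA2 hc),
          isoFar_of_not_inBlock h1 (not_inBlock_one c13 hA1 hA3 hc)⟩
      · exact ⟨isoFar_of_not_inBlock h1 (not_inBlock_one c12.symm hA2 hA1 hc),
          isoFar_of_not_inBlock h1 fun h => hA2 ⟨h, hc⟩,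
          isoFar_of_not_inBlock h1 (not_inBlock_one c23 hA2 hA3 hc)⟩
      · exact ⟨isoFar_of_not_inBlock h1 (not_inBlock_one c13.symm hA3 hA1 hc),
          isoFar_of_not_inBlock h1 (not_inBlock_one c23.symm hA3 hA2 hc),
          isoFar_of_not_inBlock h1 fun h => hA3 ⟨h, hc⟩⟩
    · right; right
      exact ⟨isoFar_of_not_inBlock h2 fun hc => hB (Or.inl hc),
        isoFar_of_not_inBlock h2 fun hc => hB (Or.inr (Or.inl hc)),
        isoFar_of_not_inBlock h2 fun hc => hB (Or.inr (Or.inr hc))⟩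

/-- **`ChainSingle` (both roots far) ⟹ doubly-symmetrised zero.** -/
theorem dsymZero_of_chainSingle (side : Fin 5 → Bool) (h1 : side 1 = true) (h2 : side 2 = true)
    (p : Pat3S ι) (hcs : ChainSingle side p) : DsymZero side p := by
  rcases chainSingle_cases h1 h2 hcs with hj | hiso | hiso
  · exact dsymZero_of_joined side h1 h2 p hj
  · exact dsymZero_of_frozenA1 side h1 p (frozenA1_of_isoFar hiso)
  · exact dsymZero_of_frozenA2 side h2 p (frozenA2_of_isoFar hiso)

end Roots

/-! ## Every dead triple is doubly-symmetrised zero -/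

section Dead

open Classical

variable {ι : Type*}

/-- **Every dead triple is doubly-symmetrised zero**: the six mechanisms of `Dead` are pointwise in
the doubly symmetrised kernel. -/
theorem dsymZero_of_dead (side : Fin 5 → Bool) (p : Pat3S ι) (hd : Dead side p) :
    DsymZero side p := by
  rcases hd with ⟨h2, hf⟩ | ⟨h1, hf⟩ | ⟨h0, hf⟩ | ⟨h4, hf⟩ | ⟨h1, h2, hj | hcs⟩
  · exact dsymZero_of_frozenA2 side h2 p hf
  · exact dsymZero_of_frozenA1 side h1 p hf
  · exact dsymZero_of_frozenO side h0 p hf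
  · exact dsymZero_of_frozenB side h4 p hf
  · exact dsymZero_of_joined side h1 h2 p hj
  · exact dsymZero_of_chainSingle side h1 h2 p hcs

end Dead

end RootBridge

end CovForm

end Summit.Ventures.PercRepro2
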